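import Summits.CriticalPhenomena.PercolationContinuityZ3.Theorems.PercNearOneGluingNoHeavyLowerTailDCSharpAnyStep
import Summits.CriticalPhenomena.PercolationContinuityZ3.Theorems.PercNearOneGluingNoHeavyLowerTailCILTwoPendantStars
import HarnessLib

/-!
# `NoHeavyLowerTail` (stmt-CriticalPhenomena-4575) — CIL at a two-pendant-stars observer from the single-pair law SHARP-ANY

Support file (prover `prim-hp-3`, hull-port line; `--supports stmt-CriticalPhenomena-4575`).  No definitions, no named facts, no sorries.

`HullPort.cil_twoPendantStars_of_sharpAny`: in the setting of `cil_twoPendantStars_of_TPS` (`o ∉ A` with positive-weight neighbours among the relays and two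
non-relays `s₁ ≠ s₂`, each pendant with relay ports; `q ∈ A` an `H`-champion), the hypothesis TPS is discharged by (DC) for the reference weight function
`w_o` (`HullPort.dc_of_sharpAny`), provided the single-pair law SHARP-ANY (`…DCSharpAnyStep.lean`) holds for the two-pendant-stars weight functions with
relays `A` and observers `s₁, s₂`.  So CIL for the first open observer class of the crux is formally reduced to SHARP-ANY (crux notes
`run/shared/lean/prim/prim-hp-3/HULLPORT-REF-gen6.md` §13).
-/

noncomputable section

namespace Summit.CriticalPhenomena.PercolationContinuityZ3.Theorems

open MeasureTheory Set Literature.Probability.LatticeModels Literature.Probability.Percolation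
open scoped Classical BigOperators

variable {n : ℕ}

namespace HullPort

/-- **CIL for the two-pendant-stars observer from SHARP-ANY.** [this work] -/
theorem cil_twoPendantStars_of_sharpAny (w : Sym2 (Fin n) → unitInterval) (A : Finset (Fin n)) (o s₁ s₂ q : Fin n) (j : ℕ)
    (hoA : o ∉ A) (hs₁A : s₁ ∉ A) (hs₂A : s₂ ∉ A) (hs₁o : s₁ ≠ o) (hs₂o : s₂ ≠ o) (h12 : s₁ ≠ s₂)
    (hobs : ∀ v, w s(o, v) ≠ 0 → v ∈ A ∨ v = s₁ ∨ v = s₂)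
    (hobs₁ : ∀ v, v ≠ o → w s(s₁, v) ≠ 0 → v ∈ A) (hobs₂ : ∀ v, v ≠ o → w s(s₂, v) ≠ 0 → v ∈ A)
    (hne₁ : ∃ v ∈ A, w s(s₁, v) ≠ 0) (hne₂ : ∃ v ∈ A, w s(s₂, v) ≠ 0)
    (hqA : q ∈ A)
    (hchamp : ∀ a ∈ A,
      (prodBernoulli w).real {ω : BondConfig (Fin n) |
          (A.filter fun z => (openGraph (ω ∩ {e | o ∉ e})).Reachable a z).card ≤ j} ≤
        (prodBernoulli w).real {ω : BondConfig (Fin n) |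
          (A.filter fun z => (openGraph (ω ∩ {e | o ∉ e})).Reachable q z).card ≤ j})
    (hSharp : (∀ w' : Sym2 (Fin n) → unitInterval, w' s(s₁, s₂) = 0 → (∀ u, w' s(s₁, u) ≠ 0 → u ∈ A) → (∀ u, w' s(s₂, u) ≠ 0 → u ∈ A) →
      ∀ v ∈ A, w' s(s₁, v) = 0 → w' s(s₂, v) = 0 →
      (∃ a ∈ A, (w' s(s₁, a) ≠ 0 ∧ w' s(s₁, a) ≠ 1) ∨ (w' s(s₂, a) ≠ 0 ∧ w' s(s₂, a) ≠ 1)) →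
      ∃ f : Sym2 (Fin n), w' f ≠ 0 ∧ w' f ≠ 1 ∧ ∃ p ∈ A, (w' s(s₁, p) ≠ 0 ∨ w' s(s₂, p) ≠ 0) ∧ ∃ m : ℝ, 0 ≤ m ∧
        (((∀ p' ∈ A, ((Function.update w' f 0) s(s₁, p') ≠ 0 ∨ (Function.update w' f 0) s(s₂, p') ≠ 0) →
            (prodBernoulli (Function.update w' f 0)).real {ω : BondConfig (Fin n) | (A.filter fun z => ω ∈ openConn p' z).card ≤ j} ≤ m) ∧
          (1 - (w' f : ℝ)) * m + (w' f : ℝ) *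
            ((prodBernoulli (Function.update w' f 1)).real {ω : BondConfig (Fin n) | (∀ x ∈ ({s₁, s₂} : Finset (Fin n)), ω ∉ openConn v x) ∧
              1 ≤ (A.filter fun z => ∃ x ∈ ({s₁, s₂} : Finset (Fin n)), ω ∈ openConn x z).card ∧
              (A.filter fun z => ∃ x ∈ ({s₁, s₂} : Finset (Fin n)), ω ∈ openConn x z).card ≤ j} +
            (prodBernoulli (Function.update w' f 1)).real {ω : BondConfig (Fin n) | (∃ x ∈ ({s₁, s₂} : Finset (Fin n)), ω ∈ openConn v x) ∧
              (A.filter fun z => ω ∈ openConn v z).card ≤ j}) ≤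
          (prodBernoulli w').real {ω : BondConfig (Fin n) | (A.filter fun z => ω ∈ openConn p z).card ≤ j}) ∨
         ((∀ p' ∈ A, ((Function.update w' f 1) s(s₁, p') ≠ 0 ∨ (Function.update w' f 1) s(s₂, p') ≠ 0) →
            (prodBernoulli (Function.update w' f 1)).real {ω : BondConfig (Fin n) | (A.filter fun z => ω ∈ openConn p' z).card ≤ j} ≤ m) ∧
          (1 - (w' f : ℝ)) *
            ((prodBernoulli (Function.update w' f 0)).real {ω : BondConfig (Fin n) | (∀ x ∈ ({s₁, s₂} : Finset (Fin n)), ω ∉ openConn v x) ∧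
              1 ≤ (A.filter fun z => ∃ x ∈ ({s₁, s₂} : Finset (Fin n)), ω ∈ openConn x z).card ∧
              (A.filter fun z => ∃ x ∈ ({s₁, s₂} : Finset (Fin n)), ω ∈ openConn x z).card ≤ j} +
            (prodBernoulli (Function.update w' f 0)).real {ω : BondConfig (Fin n) | (∃ x ∈ ({s₁, s₂} : Finset (Fin n)), ω ∈ openConn v x) ∧
              (A.filter fun z => ω ∈ openConn v z).card ≤ j}) + (w' f : ℝ) * m ≤
          (prodBernoulli w').real {ω : BondConfig (Fin n) | (A.filter fun z => ω ∈ openConn p z).card ≤ j})))) :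
    (prodBernoulli w).real {ω : BondConfig (Fin n) |
        1 ≤ (A.filter fun x => ω ∈ openConn o x).card ∧ (A.filter fun x => ω ∈ openConn o x).card ≤ j} ≤
      (prodBernoulli w).real {ω : BondConfig (Fin n) | (A.filter fun x => ω ∈ openConn q x).card ≤ j} := by
  set wo : Sym2 (Fin n) → unitInterval := fun e => if e ∈ {e : Sym2 (Fin n) | o ∉ e} then w e else 0 with hwo
  have hwo_of : ∀ u v : Fin n, o ∉ s(u, v) → wo s(u, v) = w s(u, v) := by
    intro u v h
    simp only [hwo, Set.mem_setOf_eq, h, not_false_eq_true, if_true]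
  have hwo_zero : ∀ u v : Fin n, o ∈ s(u, v) → wo s(u, v) = 0 := by
    intro u v h
    have : ¬ (o ∉ s(u, v)) := fun h' => h' h
    simp only [hwo, Set.mem_setOf_eq, this, if_false]
  have hw12 : wo s(s₁, s₂) = 0 := by
    by_cases h : o ∈ s(s₁, s₂)
    · exact hwo_zero s₁ s₂ h
    · rw [hwo_of s₁ s₂ h]
      by_contra hne
      exact hs₂A (hobs₁ s₂ hs₂o hne)
  have hpend : ∀ s : Fin n, (∀ v, v ≠ o → w s(s, v) ≠ 0 → v ∈ A) → ∀ u, wo s(s, u) ≠ 0 → u ∈ A := by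
    intro s hs u hu
    by_cases h : o ∈ s(s, u)
    · exact absurd (hwo_zero s u h) hu
    · have huo : u ≠ o := fun h' => h (h' ▸ Sym2.mem_mk_right s u)
      rw [hwo_of s u h] at hu
      exact hs u huo hu
  obtain ⟨p, hpA, hp_or, hp_le⟩ :=
    dc_of_sharpAny A s₁ s₂ j hSharp wo hs₁A hs₂A h12 hw12 (hpend s₁ hobs₁) (hpend s₂ hobs₂) q hqA
  have hIq : (prodBernoulli wo).real {ω : BondConfig (Fin n) | (A.filter fun z => ω ∈ openConn p z).card ≤ j} ≤
      (prodBernoulli wo).real {ω : BondConfig (Fin n) | (A.filter fun z => ω ∈ openConn q z).card ≤ j} := by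
    have h := hchamp p hpA
    rw [TwoPendantStars.real_lightness_avoid w A o p j, TwoPendantStars.real_lightness_avoid w A o q j] at h
    exact h
  have hE := hp_le.trans hIq
  refine cil_twoPendantStars_of_TPS w A o s₁ s₂ q j hoA hs₁A hs₂A hs₁o hs₂o hobs hobs₁ hobs₂ hne₁ hne₂ hqA hchamp ?_
  have hCS := setCS_of_obsE_le wo A {s₁, s₂} q j hE
  convert hCS using 12

end HullPort

end Summit.CriticalPhenomena.PercolationContinuityZ3.Theorems

end
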